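import Mathlib.NumberTheory.LocalField.Basic
import Mathlib.RepresentationTheory.Basic
import Mathlib.FieldTheory.Galois.Basic
import Mathlib.NumberTheory.Padics.RingHoms
import Mathlib.NumberTheory.Multiplicity
import Summits.BirchSwinnertonDyer.Rank1Residual.GaloisImage.ModPLatticeHerbrandCount
import HarnessLib

/-!
# The one-units `U_k = 1 + p^k 𝒪_E` of a local field as Galois modules, modulo `p`
# (cell `b2b-bsdres`, team n1011, row T-EPC = Tate's local Euler–Poincaré characteristic; seat p04 GEN 7; stage B1)

HONEST FRAMING (cell `b2b-bsdres`, run/shared/lean/b2b/bsd-rank1-residual/, verbatim in every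
file): the goal of the cell is to DELETE the COMBINATION-SHAPED residual classes of the
Birch–Swinnerton-Dyer formula for ALL analytic-rank `≤ 1` elliptic curves over `ℚ` — "full BSD
formula for every rank `≤ 1` curve in class `C`" assembled STRICTLY from published theorems — so
that the rank-`≤ 1` remainder becomes exactly the CONSTRUCTION-SHAPED classes, which are TYPED
(missing-input `Prop`s), NOT attempted. This is not "finishing BSD". Team n1011 (N10 / N11, the
additive block X4 ∧ `p = 3`): research route; no claim beyond the stated classes; nothing is
booked; no mark / label is changed by this file. Theorems only (no definition, no named fact, no
`sorry`); TOOL theorems on local fields.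

## What

Let `E` be a non-archimedean local field of characteristic `0` and residue characteristic `p`
(`|p| < 1`), `K` a subfield with `E/K` finite Galois, `Δ = Gal(E/K) = E ≃ₐ[K] E` acting on `Eˣ`
(Mathlib's `MulDistribMulAction (E ≃ₐ[K] E) Eˣ`, as the representation
`Representation.ofMulDistribMulAction Δ Eˣ` on `Additive Eˣ`) and preserving the valuation.  The
**one-units of level `k`**, `U_k = {u ∈ Eˣ | u = 1 + p^k b, b ∈ 𝒪_E}` (`k ≥ 1`), are `Δ`-stable
subgroups with `U_{k+1} ≤ U_k`, `U_k^p ≤ U_{k+1}`, `U_2` has no `p`-torsion, and the DIGIT map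
`1 + p² b ↦ b mod p` is a `Δ`-equivariant surjection `U_2 → 𝒪_E/p𝒪_E` with kernel `U_3`
(Serre, *Local Fields*, IV §2 Prop. 6 and §3 Prop. 9: `U^n/U^{n+1} ≅ 𝔭^n/𝔭^{n+1}`, `x ↦ x^p`
maps `U^n` to `U^{n+e}`).  This is the log-free input replacing "the exponential map sends an open
subgroup of `U` onto an open subgroup of `R_L`" in Milne's proof of *ADT* I Thm. 2.8 (Lemma 2.12
applied to `W = U`).  We phrase subgroups of `Eˣ` as `ℤ`-submodules of `Additive Eˣ` CHARACTERISED
by membership (no new definition):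

* `OneUnits.exists_submodule` — existence of `U_k` as a `ℤ`-submodule of `Additive Eˣ`;
* `OneUnits.le_comap` (`Δ`-stability), `OneUnits.antitone`, `OneUnits.nsmul_mem_one`
  (`U_1^p ≤ U_2`), `OneUnits.nsmul_mem_two` (`U_2^p ≤ U_3` with the same digit),
  `OneUnits.torsionFree_two` (`U_2[p] = 1`);
* `OneUnits.exists_digitHom` — the digit map `U_2 → 𝒪_E/p𝒪_E` as a surjective intertwining map
  to the canonical mod-`p` quotient of the representation on `(𝒪_E, +)`, with kernel `U_3`.

References: J.-P. Serre, *Local Fields* (GTM 67), IV §2 Prop. 6, §3 Prop. 9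
[SerreLocalFields1979]; J. S. Milne, *Arithmetic Duality Theorems* (2006), I §2, proof of Thm. 2.8
(Lemmas 2.11–2.12) [MilneADT2006].
-/

noncomputable section

open Function
open scoped ValuativeRel

namespace Summit.BirchSwinnertonDyer.Rank1Residual.GaloisImage

namespace OneUnits

open Representation

variable {K : Type*} [Field K] {E : Type*} [Field E] [Algebra K E] [ValuativeRel E]
variable (p : ℕ) [hp : Fact p.Prime]

/-! ### One-units of level `k`: closure properties in `Eˣ` -/

section Algebra

omit hp in
/-- The valuation of `1 + p^k b` is `1` for `b ∈ 𝒪_E`, `k ≥ 1`, `|p| < 1`. [folklore] -/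
theorem valuation_one_add_eq_one (hpv : ValuativeRel.valuation E p < 1) {k : ℕ} (hk : 1 ≤ k) {b : E}
    (hb : b ∈ 𝒪[E]) : ValuativeRel.valuation E (1 + (p : E) ^ k * b) = 1 := by
  have hlt : ValuativeRel.valuation E ((p : E) ^ k * b) < 1 := by
    rw [map_mul, map_pow]
    have h1 : ValuativeRel.valuation E (p : E) ^ k < 1 := pow_lt_one₀ zero_le hpv (by omega)
    calc ValuativeRel.valuation E (p : E) ^ k * ValuativeRel.valuation E b
        ≤ ValuativeRel.valuation E (p : E) ^ k * 1 := by
          gcongr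
          exact (Valuation.mem_integer_iff _ _).1 hb
      _ < 1 := by rw [mul_one]; exact h1
  rw [Valuation.map_add_eq_of_lt_left _ (by rwa [map_one]), map_one]

omit hp in
/-- `p^k ∈ 𝒪_E` and `𝒪_E` is closed under the ring operations: the digit of a product,
`(1 + p^k a)(1 + p^k b) = 1 + p^k (a + b + p^k a b)`. [folklore] -/
theorem mul_digit_mem (hpv : ValuativeRel.valuation E p < 1) (k : ℕ) {a b : E} (ha : a ∈ 𝒪[E])
    (hb : b ∈ 𝒪[E]) : a + b + (p : E) ^ k * a * b ∈ 𝒪[E] := by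
  have hpk : (p : E) ^ k ∈ 𝒪[E] := Subring.pow_mem _ ((Valuation.mem_integer_iff _ _).2 hpv.le) k
  exact Subring.add_mem _ (Subring.add_mem _ ha hb) (Subring.mul_mem _ (Subring.mul_mem _ hpk ha) hb)

omit hp in
/-- A one-unit `u = 1 + p^k b` (`k ≥ 1`, `b ∈ 𝒪_E`) has `u⁻¹ ∈ 𝒪_E`. [folklore] -/
theorem inv_mem_integer (hpv : ValuativeRel.valuation E p < 1) {k : ℕ} (hk : 1 ≤ k) {u : Eˣ} {b : E}
    (hb : b ∈ 𝒪[E]) (hu : (u : E) = 1 + (p : E) ^ k * b) : ((u⁻¹ : Eˣ) : E) ∈ 𝒪[E] := by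
  rw [Valuation.mem_integer_iff, Units.val_inv_eq_inv_val, map_inv₀, hu,
    valuation_one_add_eq_one p hpv hk hb, inv_one]

omit hp in
/-- **The one-units of level `k ≥ 1` form a subgroup of `Eˣ`**, here produced as a `ℤ`-submodule
`U_k` of `Additive Eˣ` characterised by membership:
`u ∈ U_k ↔ ∃ b ∈ 𝒪_E, u = 1 + p^k b`. [cite: SerreLocalFields1979, IV §2 Prop. 6] -/
theorem exists_submodule (hpv : ValuativeRel.valuation E p < 1) {k : ℕ} (hk : 1 ≤ k) :
    ∃ U : Submodule ℤ (Additive Eˣ), ∀ u : Additive Eˣ,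
      u ∈ U ↔ ∃ b ∈ 𝒪[E], ((Additive.toMul u : Eˣ) : E) = 1 + (p : E) ^ k * b := by
  let S : Subgroup Eˣ :=
    { carrier := {u | ∃ b ∈ 𝒪[E], (u : E) = 1 + (p : E) ^ k * b}
      mul_mem' := by
        rintro u w ⟨a, ha, hu⟩ ⟨b, hb, hw⟩
        refine ⟨a + b + (p : E) ^ k * a * b, mul_digit_mem p hpv k ha hb, ?_⟩
        rw [Units.val_mul, hu, hw]; ring
      one_mem' := ⟨0, Subring.zero_mem _, by simp⟩
      inv_mem' := by
        rintro u ⟨a, ha, hu⟩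
        refine ⟨-(a * ((u⁻¹ : Eˣ) : E)), Subring.neg_mem _ (Subring.mul_mem _ ha
          (inv_mem_integer p hpv hk ha hu)), ?_⟩
        have h1 : ((u⁻¹ : Eˣ) : E) * (u : E) = 1 := by
          rw [← Units.val_mul, inv_mul_cancel, Units.val_one]
        have h2 : ((u⁻¹ : Eˣ) : E) * (1 + (p : E) ^ k * a) = 1 := by rw [← hu]; exact h1
        linear_combination h2 }
  refine ⟨AddSubgroup.toIntSubmodule (Subgroup.toAddSubgroup S), fun u => ?_⟩
  exact Iff.rfl

end Algebra

/-! ### Galois stability -/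

section Galois

omit hp in
/-- A `K`-automorphism preserving the valuation preserves `𝒪_E`. [folklore] -/
theorem map_mem_integer {σ : E ≃ₐ[K] E}
    (hσ : ∀ x : E, ValuativeRel.valuation E (σ x) = ValuativeRel.valuation E x) {b : E}
    (hb : b ∈ 𝒪[E]) : σ b ∈ 𝒪[E] := by
  rw [Valuation.mem_integer_iff, hσ]; exact (Valuation.mem_integer_iff _ _).1 hb

omit hp [ValuativeRel E] in
/-- The action of `Gal(E/K)` on `Additive Eˣ` (Mathlib's `MulDistribMulAction (E ≃ₐ[K] E) Eˣ`),
unfolded on values: `(σ • u : E) = σ u`. [folklore] -/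
theorem coe_ofMulDistribMulAction_apply (σ : E ≃ₐ[K] E) (u : Additive Eˣ) :
    ((Additive.toMul (Representation.ofMulDistribMulAction (E ≃ₐ[K] E) Eˣ σ u) : Eˣ) : E) =
      σ ((Additive.toMul u : Eˣ) : E) := rfl

omit hp in
/-- **`U_k` is `Gal(E/K)`-stable** when the Galois group preserves the valuation:
`σ(1 + p^k b) = 1 + p^k σ(b)`. [cite: SerreLocalFields1979, IV §2] -/
theorem le_comap (hσ : ∀ (σ : E ≃ₐ[K] E) (x : E), ValuativeRel.valuation E (σ x) = ValuativeRel.valuation E x)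
    {k : ℕ} (U : Submodule ℤ (Additive Eˣ))
    (hU : ∀ u : Additive Eˣ, u ∈ U ↔ ∃ b ∈ 𝒪[E], ((Additive.toMul u : Eˣ) : E) = 1 + (p : E) ^ k * b)
    (σ : E ≃ₐ[K] E) :
    U ≤ U.comap (Representation.ofMulDistribMulAction (E ≃ₐ[K] E) Eˣ σ) := by
  intro u hu
  obtain ⟨b, hb, hub⟩ := (hU u).1 hu
  rw [Submodule.mem_comap, hU, coe_ofMulDistribMulAction_apply, hub]
  exact ⟨σ b, map_mem_integer (hσ σ) hb, by simp [map_add, map_mul, map_pow]⟩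

end Galois

/-! ### `U_{k+1} ≤ U_k`, `U_k^p ≤ U_{k+1}`, and `U_2` has no `p`-torsion -/

section Powers

omit hp [ValuativeRel E] in
/-- Unfolding `n • u` in `Additive Eˣ`: `toMul (n • u) = (toMul u)^n`. [folklore] -/
theorem coe_toMul_nsmul (n : ℕ) (u : Additive Eˣ) :
    ((Additive.toMul (n • u) : Eˣ) : E) = ((Additive.toMul u : Eˣ) : E) ^ n := by
  rw [toMul_nsmul, Units.val_pow_eq_pow_val]

omit hp in
/-- `U_{k+1} ≤ U_k`. [folklore] -/
theorem antitone (hpv : ValuativeRel.valuation E p < 1) {k : ℕ}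
    (U U' : Submodule ℤ (Additive Eˣ))
    (hU : ∀ u : Additive Eˣ, u ∈ U ↔ ∃ b ∈ 𝒪[E], ((Additive.toMul u : Eˣ) : E) = 1 + (p : E) ^ k * b)
    (hU' : ∀ u : Additive Eˣ, u ∈ U' ↔ ∃ b ∈ 𝒪[E], ((Additive.toMul u : Eˣ) : E) = 1 + (p : E) ^ (k + 1) * b) :
    U' ≤ U := by
  intro u hu
  obtain ⟨b, hb, hub⟩ := (hU' u).1 hu
  refine (hU u).2 ⟨(p : E) * b, Subring.mul_mem _ ((Valuation.mem_integer_iff _ _).2 hpv.le) hb, ?_⟩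
  rw [hub, pow_succ]; ring

omit hp in
/-- The binomial identity behind `U_k^p ≤ U_{k+1}`: in `𝒪_E`,
`(1 + y)^p = 1 + p y + y² c` for some `c`. [folklore] -/
theorem exists_one_add_pow_prime (y : 𝒪[E]) :
    ∃ c : 𝒪[E], (1 + y) ^ p = 1 + (p : 𝒪[E]) * y + y ^ 2 * c := by
  obtain ⟨c, hc⟩ := sq_dvd_add_pow_sub_sub y (1 : 𝒪[E]) p
  refine ⟨c, ?_⟩
  have hc' : (1 + y) ^ p - 1 ^ (p - 1) * y * p - 1 ^ p = y ^ 2 * c := hc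
  rw [one_pow, one_pow, one_mul] at hc'
  linear_combination hc'

omit hp in
/-- The `p`-th power of a one-unit of level `k ≥ 1` is a one-unit of level `k + 1`, with digit
`b + p^{k-1} b² c`. [cite: SerreLocalFields1979, IV §3 Prop. 9] -/
theorem exists_pow_prime_digit (hpv : ValuativeRel.valuation E p < 1) {k : ℕ} (hk : 1 ≤ k) {u : Eˣ}
    {b : E} (hb : b ∈ 𝒪[E]) (hu : (u : E) = 1 + (p : E) ^ k * b) :
    ∃ c ∈ 𝒪[E], ((u ^ p : Eˣ) : E) = 1 + (p : E) ^ (k + 1) * (b + (p : E) ^ (k - 1) * b ^ 2 * c) := by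
  have hy : (p : E) ^ k * b ∈ 𝒪[E] :=
    Subring.mul_mem _ (Subring.pow_mem _ ((Valuation.mem_integer_iff _ _).2 hpv.le) k) hb
  obtain ⟨c, hc⟩ := exists_one_add_pow_prime p (⟨(p : E) ^ k * b, hy⟩ : 𝒪[E])
  refine ⟨c, c.2, ?_⟩
  have hc' := congrArg (fun t : 𝒪[E] => (t : E)) hc
  simp only [Subring.coe_pow, Subring.coe_add, Subring.coe_one, Subring.coe_mul,
    Subring.coe_natCast] at hc'
  rw [Units.val_pow_eq_pow_val, hu, hc']
  obtain ⟨k', rfl⟩ := Nat.exists_eq_add_of_le hk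
  simp only [Nat.add_sub_cancel_left, pow_succ, pow_add]
  ring

omit hp in
/-- **`U_k^p ≤ U_{k+1}`** (`k ≥ 1`): `p • u ∈ U_{k+1}` for `u ∈ U_k` (additive notation).
[cite: SerreLocalFields1979, IV §3 Prop. 9] -/
theorem nsmul_mem_succ (hpv : ValuativeRel.valuation E p < 1) {k : ℕ} (hk : 1 ≤ k)
    (U U' : Submodule ℤ (Additive Eˣ))
    (hU : ∀ u : Additive Eˣ, u ∈ U ↔ ∃ b ∈ 𝒪[E], ((Additive.toMul u : Eˣ) : E) = 1 + (p : E) ^ k * b)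
    (hU' : ∀ u : Additive Eˣ, u ∈ U' ↔ ∃ b ∈ 𝒪[E], ((Additive.toMul u : Eˣ) : E) = 1 + (p : E) ^ (k + 1) * b)
    {u : Additive Eˣ} (hu : u ∈ U) : p • u ∈ U' := by
  obtain ⟨b, hb, hub⟩ := (hU u).1 hu
  obtain ⟨c, hc, hpow⟩ := exists_pow_prime_digit p hpv hk hb hub
  refine (hU' _).2 ⟨b + (p : E) ^ (k - 1) * b ^ 2 * c, ?_, ?_⟩
  · have hpE : (p : E) ∈ 𝒪[E] := (Valuation.mem_integer_iff _ _).2 hpv.le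
    exact Subring.add_mem _ hb (Subring.mul_mem _ (Subring.mul_mem _ (Subring.pow_mem _ hpE _)
      (Subring.pow_mem _ hb 2)) hc)
  · rw [toMul_nsmul]
    exact hpow

omit hp in
/-- **`U_2` has no `p`-torsion** (characteristic `0`): if `u = 1 + p² b` and `u^p = 1` then
`b (1 + p b c) = 0` with `1 + p b c` a unit, so `u = 1`.
[cite: SerreLocalFields1979, IV §3 Prop. 9] -/
theorem torsionFree_two [CharZero E] (hpv : ValuativeRel.valuation E p < 1) (hp0 : p ≠ 0)
    (U : Submodule ℤ (Additive Eˣ))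
    (hU : ∀ u : Additive Eˣ, u ∈ U ↔ ∃ b ∈ 𝒪[E], ((Additive.toMul u : Eˣ) : E) = 1 + (p : E) ^ 2 * b)
    {u : Additive Eˣ} (hu : u ∈ U) (hpu : p • u = 0) : u = 0 := by
  obtain ⟨b, hb, hub⟩ := (hU u).1 hu
  obtain ⟨c, hc, hpow⟩ := exists_pow_prime_digit p hpv (by norm_num : 1 ≤ 2) hb hub
  have h1 : ((Additive.toMul (p • u) : Eˣ) : E) = 1 := by rw [hpu, toMul_zero, Units.val_one]
  rw [toMul_nsmul, hpow] at h1
  have hpE : (p : E) ≠ 0 := Nat.cast_ne_zero.2 hp0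
  have h2 : b * (1 + (p : E) ^ 1 * (b * c)) = 0 := by
    have h3 : (p : E) ^ 3 * (b + (p : E) ^ (2 - 1) * b ^ 2 * c) = 0 := by
      linear_combination h1
    rcases mul_eq_zero.1 h3 with h | h
    · exact absurd h (pow_ne_zero _ hpE)
    · linear_combination h
  have hunit : (1 + (p : E) ^ 1 * (b * c)) ≠ 0 := fun h0 => by
    have := valuation_one_add_eq_one p hpv le_rfl (Subring.mul_mem _ hb hc) (E := E)
    rw [h0, map_zero] at this
    exact zero_ne_one this
  have hb0 : b = 0 := by
    rcases mul_eq_zero.1 h2 with h | h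
    · exact h
    · exact absurd h hunit
  have hu1 : (Additive.toMul u : Eˣ) = 1 := Units.ext (by rw [hub, hb0, mul_zero, add_zero, Units.val_one])
  rw [← ofMul_toMul u, hu1, ofMul_one]

end Powers

/-! ### The digit map `U_2 → 𝒪_E / p 𝒪_E` -/

section Digit

omit hp [ValuativeRel E] in
/-- The digit `(u - 1)/p²` of `u = 1 + p² b` is `b`. [folklore] -/
theorem digit_eq (hp0 : (p : E) ≠ 0) {u b : E} (hu : u = 1 + (p : E) ^ 2 * b) :
    (u - 1) / (p : E) ^ 2 = b := by
  rw [hu, add_sub_cancel_left, mul_div_cancel_left₀ _ (pow_ne_zero _ hp0)]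

omit hp in
/-- **The digit map** `U_2 → 𝒪_E/p𝒪_E`, `1 + p² b ↦ b mod p`: a surjective `Gal(E/K)`-equivariant
homomorphism with kernel `U_3` (Serre's isomorphisms `U^n/U^{n+1} ≅ 𝔭^n/𝔭^{n+1}` at the levels
`𝔭^n = p² 𝒪_E ⊇ 𝔭^{n+…} = p³ 𝒪_E`), valued in the canonical mod-`p` quotient of the
representation of `Gal(E/K)` on `(𝒪_E, +)`. [cite: SerreLocalFields1979, IV §2 Prop. 6] -/
theorem exists_digitHom (hpv : ValuativeRel.valuation E p < 1) (hp0 : (p : E) ≠ 0)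
    (U₂ U₃ : Submodule ℤ (Additive Eˣ))
    (hU₂ : ∀ u : Additive Eˣ, u ∈ U₂ ↔ ∃ b ∈ 𝒪[E], ((Additive.toMul u : Eˣ) : E) = 1 + (p : E) ^ 2 * b)
    (hU₃ : ∀ u : Additive Eˣ, u ∈ U₃ ↔ ∃ b ∈ 𝒪[E], ((Additive.toMul u : Eˣ) : E) = 1 + (p : E) ^ 3 * b)
    (hU₂st : ∀ σ, U₂ ≤ U₂.comap (Representation.ofMulDistribMulAction (E ≃ₐ[K] E) Eˣ σ))
    (O : Submodule ℤ E) (hO : ∀ x, x ∈ O ↔ x ∈ 𝒪[E])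
    (hOst : ∀ σ, O ≤ O.comap (Representation.ofDistribMulAction ℤ (E ≃ₐ[K] E) E σ)) :
    ∃ φ : IntertwiningMap ((Representation.ofMulDistribMulAction (E ≃ₐ[K] E) Eˣ).subrepresentation U₂ hU₂st)
        (((Representation.ofDistribMulAction ℤ (E ≃ₐ[K] E) E).subrepresentation O hOst).quotient _
          (ModPRepCount.range_lsmul_le_comap
            ((Representation.ofDistribMulAction ℤ (E ≃ₐ[K] E) E).subrepresentation O hOst) p)),
      Surjective φ ∧ ∀ u : U₂, φ u = 0 ↔ (u : Additive Eˣ) ∈ U₃ := by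
  set ρU := Representation.ofMulDistribMulAction (E ≃ₐ[K] E) Eˣ with hρU
  set ρE := Representation.ofDistribMulAction ℤ (E ≃ₐ[K] E) E with hρE
  set ρO := ρE.subrepresentation O hOst with hρO
  set PO : Submodule ℤ O := LinearMap.range (LinearMap.lsmul ℤ O p) with hPO
  -- the digit
  have hd : ∀ u : U₂, (((Additive.toMul (u : Additive Eˣ) : Eˣ) : E) - 1) / (p : E) ^ 2 ∈ O := fun u => by
    obtain ⟨b, hb, hub⟩ := (hU₂ u).1 u.2
    rw [digit_eq p hp0 hub, hO]; exact hb
  let d : U₂ → O := fun u => ⟨_, hd u⟩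
  have d_spec : ∀ (u : U₂) {b : E}, ((Additive.toMul (u : Additive Eˣ) : Eˣ) : E) = 1 + (p : E) ^ 2 * b →
      (d u : E) = b := fun u b hub => digit_eq p hp0 hub
  -- additivity modulo `p`
  have d_add : ∀ u w : U₂, PO.mkQ (d (u + w)) = PO.mkQ (d u) + PO.mkQ (d w) := by
    intro u w
    obtain ⟨a, ha, hua⟩ := (hU₂ u).1 u.2
    obtain ⟨b, hb, hwb⟩ := (hU₂ w).1 w.2
    have huw : ((Additive.toMul ((u + w : U₂) : Additive Eˣ) : Eˣ) : E) =
        1 + (p : E) ^ 2 * (a + b + (p : E) ^ 2 * a * b) := by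
      rw [Submodule.coe_add, toMul_add, Units.val_mul, hua, hwb]; ring
    rw [← map_add, ← sub_eq_zero, ← map_sub, Submodule.mkQ_apply, Submodule.Quotient.mk_eq_zero, hPO,
      LinearMap.mem_range]
    refine ⟨⟨(p : E) * a * b, (hO _).2 (Subring.mul_mem _ (Subring.mul_mem _
      ((Valuation.mem_integer_iff _ _).2 hpv.le) ha) hb)⟩, Subtype.ext ?_⟩
    rw [LinearMap.lsmul_apply, Submodule.coe_smul_of_tower, Submodule.coe_sub, Submodule.coe_add,
      d_spec _ huw, d_spec _ hua, d_spec _ hwb]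
    simp only [zsmul_eq_mul, Int.cast_natCast]
    ring
  let ψ : U₂ →+ O ⧸ PO := AddMonoidHom.mk' (fun u => PO.mkQ (d u)) d_add
  have hψ : ∀ u : U₂, ψ u = PO.mkQ (d u) := fun u => rfl
  -- equivariance
  have d_smul : ∀ (σ : E ≃ₐ[K] E) (u : U₂),
      d ((ρU.subrepresentation U₂ hU₂st) σ u) = ρO σ (d u) := by
    intro σ u
    obtain ⟨b, hb, hub⟩ := (hU₂ u).1 u.2
    have hσu : ((Additive.toMul (((ρU.subrepresentation U₂ hU₂st) σ u : U₂) : Additive Eˣ) : Eˣ) : E) =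
        1 + (p : E) ^ 2 * σ b := by
      change ((Additive.toMul (ρU σ (u : Additive Eˣ)) : Eˣ) : E) = _
      rw [coe_ofMulDistribMulAction_apply, hub]
      simp [map_add, map_mul, map_pow]
    refine Subtype.ext ?_
    rw [d_spec _ hσu]
    change σ b = σ • ((d u : O) : E)
    rw [AlgEquiv.smul_def, d_spec _ hub]
  refine ⟨ψ.toIntLinearMap.intertwiningMap_of_isIntertwiningMap _ _ (fun σ u => ?_), ?_, ?_⟩
  · change ψ ((ρU.subrepresentation U₂ hU₂st) σ u) = (ρO.quotient PO _) σ (ψ u)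
    rw [hψ, hψ, d_smul, Representation.quotient_apply, Submodule.mkQ_apply, Submodule.mkQ_apply,
      Submodule.mapQ_apply]
  · -- surjective
    intro q
    obtain ⟨x, rfl⟩ := Submodule.mkQ_surjective PO q
    have hx : (x : E) ∈ 𝒪[E] := (hO _).1 x.2
    have hne : (1 + (p : E) ^ 2 * (x : E)) ≠ 0 := fun h0 => by
      have := valuation_one_add_eq_one p hpv (by norm_num : 1 ≤ 2) hx (E := E)
      rw [h0, map_zero] at this
      exact zero_ne_one this
    have hmem : Additive.ofMul (Units.mk0 _ hne) ∈ U₂ := (hU₂ _).2 ⟨x, hx, rfl⟩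
    refine ⟨⟨_, hmem⟩, ?_⟩
    change ψ ⟨_, hmem⟩ = _
    rw [hψ, Submodule.mkQ_apply]
    exact congrArg _ (Subtype.ext (d_spec ⟨_, hmem⟩ rfl))
  · -- kernel
    intro u
    obtain ⟨b, hb, hub⟩ := (hU₂ u).1 u.2
    change ψ u = 0 ↔ _
    rw [hψ, Submodule.mkQ_apply, Submodule.Quotient.mk_eq_zero, hPO, LinearMap.mem_range, hU₃]
    constructor
    · rintro ⟨c, hc⟩
      have hc' := congrArg (fun t : O => (t : E)) hc
      simp only [LinearMap.lsmul_apply, Submodule.coe_smul_of_tower, d_spec _ hub, zsmul_eq_mul,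
        Int.cast_natCast] at hc'
      refine ⟨(c : E), (hO _).1 c.2, ?_⟩
      rw [hub, ← hc']; ring
    · rintro ⟨c, hc, huc⟩
      refine ⟨⟨c, (hO _).2 hc⟩, Subtype.ext ?_⟩
      rw [LinearMap.lsmul_apply, Submodule.coe_smul_of_tower, d_spec _ hub, zsmul_eq_mul, Int.cast_natCast]
      have h2 : (1 : E) + (p : E) ^ 2 * b = 1 + (p : E) ^ 3 * c := hub.symm.trans huc
      have h3 : (p : E) ^ 2 * (b - p * c) = 0 := by linear_combination h2
      rcases mul_eq_zero.1 h3 with h | h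
      · exact absurd h (pow_ne_zero _ hp0)
      · change (p : E) * c = b; linear_combination -h

end Digit

end OneUnits

end Summit.BirchSwinnertonDyer.Rank1Residual.GaloisImage

end
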